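import Mathlib
import Literature.Computability.QuantumComplexity.GaussianRank
import Summits.QuantumAdvantage.QuantumAdvantage.Theses.SpinorFlattening
import Summits.QuantumAdvantage.QuantumAdvantage.Theorems.GaussRankTwoCopies.Negative.TightFour

/-!
# Line `e8-cartan-quotient` — CHECKED skeleton for the crux `SpinorFlattening.GaussRankTwoCopies`
# (stmt-QuantumAdvantage-1248; route `route-QuantumAdvantage-SpinorFlattening`, rank-5 crux `χ_G(M⊗M) ≥ 4`)

crux-plan seat `planner-cruxplan-stmt-QuantumAdvantage-1248-e8-cartan-quotient-0`, 2026-08-16 (opening,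
round 1). Idea card `Cruxes/GaussRankTwoCopies/Ideas/e8-cartan-quotient.md` (crux-ideate r1, ideator 1);
triage r1-1 / r1-2 / r1-3: pass × 3 ("correct paper proof of BORDER rank 4; heaviest to formalise").
Line card: `Cruxes/GaussRankTwoCopies/Lines/e8-cartan-quotient.md`.

## The line in one paragraph

`Δ₊(16)` — the even sector of the 8-mode Fock space, where `M⊗M` and every even Gaussian state live — is
the isotropy module `𝔭` of the split symmetric pair `(e₈, so(16))`, so every even 8-qubit vector `x` has a
Jordan decomposition, a semisimple part conjugate into an 8-dimensional Cartan subspace `𝔞`, and a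
`W(E₈)`-orbit of "root values" `{α(s)}`; the MOMENT MATRIX `T(x)_{st} = B(x, c_s c_t x)` (`B` = the
`Spin(16)`-invariant bilinear form, `s, t` = bivector labels of `so(16)`) is, up to a nonzero constant, the
matrix of `(ad x)²|so(16)`, so `charpoly T(x) = ∏_{α ∈ Φ⁺(E₈)} (X − κ·α(s)²)`. LEVER (Kostant–Rallis
adjoint quotient): a sum of three EVEN pure spinors with pairwise transverse annihilator Lagrangians is
fixed by a copy of `sp(8)` (dim 36, simple), which must sit in the `𝔨`-part of the Levi centraliser of
`s`; the Levi subsystems of `E₈` with `≥ 72` roots are `E₈, E₇, D₇, E₆A₁, E₆`, and `D₇` is excluded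
(`sp(8) ⊄ so(7) ⊕ so(7)`), so `s` is orthogonal to an `E₆` subsystem and the spectrum of `T(x)` has the
`E₆T₂` SHAPE `{0³⁶, u₁²⁷, u₂²⁷, u₃²⁷, v₁, v₂, v₃}` (`stub_transverseShape`, the load-bearing stub). The
shape locus is closed (`stub_shapeClosed`: image of a finite = proper coefficient map) and transverse even
triples are dense in all even Gaussian triples (`stub_transverseDense`: perturb along `exp(θ c_p c_q)`),
so EVERY even 3-term Gaussian sum has the shape. On the other side `M⊗M` is the `D₇`-coweight: its moment
matrix has spectrum `{0⁴², c⁶⁴, (4c)¹⁴}` (`stub_twoCopiesSpectrum`, one finite exact computation; confirmed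
exactly mod p by three independent codes on the item record), and `42 ∉ 36 + 27·{0..3} + {0..3}`: the
multiplicity of the eigenvalue `0` alone separates `M⊗M` from the third secant CONE — border rank 4, a
fortiori the crux. Odd Gaussian terms are disposed of first: every Gaussian state has a parity
(`stub_gaussianParity`, vacuum-line uniqueness), `M⊗M` is even, and the even projection of a 3-term
decomposition is a 3-term EVEN decomposition (odd terms replaced by `0 • |0⁸⟩`).

## Composition (kernel-checked, no `sorry` of its own)

`GaussRankTwoCopies_of : GaussRankTwoCopies := fun a g hg => twoCopies_of_stubs stub_gaussianParity
  stub_transverseShape stub_shapeClosed stub_transverseDense stub_twoCopiesSpectrum a g hg`, where the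
chain below takes the five stub STATEMENTS as hypotheses and is PROVED here:
`even_redecomposition` (S1 ⇒ the even projection of any 3-term Gaussian sum is a 3-term EVEN Gaussian
sum; `evenProj_magicMPow_two` by `decide` on 8 bits) → `shape_of_even` (S2 + S3 + S4,
`IsClosed.closure_subset_iff`) → **`borderRank_of_stubs : M⊗M ∉ closure allSums`** (continuity of
`evenProj`; `rootMult_zero_shapePoly`: multiplicity of the root 0 of the shape is `36 + 27a + b`,
`a, b ≤ 3`; `rootMult_zero_twoCopiesShape`: it is `42` for `M⊗M`; `omega`) →
**`distBound_of_stubs : ∃ c > 0, ∀ 3-term Gaussian combinations, c ≤ normSq (M⊗M − Σ aᵢgᵢ)`** (Disproof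
§3's open strengthening, via `Metric.mem_closure_iff` and `dist² ≤ normSq`) → `twoCopies_of_stubs` (the
named form of the crux, as in Disproof `crux_of_distBound`) → the crux BY NAME. So the registered stubs
certify border rank 4 and the metric gap on the way to the crux. Dependency DAG: S1 → even
re-decomposition; (S2, S3, S4) → shape_of_even; (those, S5) → border → gap → crux.

## Vocabulary policy (for the lead)

There is NO `def … : Prop` in this file. §1 holds eight short DATA definitions over tree vocabulary
(`MajIdx`, `key`, `SoIdx` = the 120 bivector labels; `maj2`; `chargeConj` = `X⊗Y⊗X⊗Y⊗X⊗Y⊗X⊗Y`;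
`bilin` = `φᵀ C ψ`; `momentT`; `evenProj`; `shapePoly`) and two `Set`-valued ones (`shapeLocus`,
`transverseSums`) that name the two sets S2–S4 are about. They are written to be landed VERBATIM as a
definitions-only support module (suggested `Theorems/SpinorFlatteningGaussRankTwoCopiesE8Defs.lean
--supports stmt-QuantumAdvantage-1248`; precedents p73272 `TwistAmplificationSharpModerateLawDefs`,
p72483), after which every stub lands verbatim by name + signature. Conventions = the item's evidence
codes (`e8probe.py` j008373, `triage_checks.py` j010601, `CHECKS.md` r1-2, `triage3.py` j010554): JW
Majoranas `majorana (2*4) j b` of `GaussianRank.lean`, `C = XYXYXYXY`, `T(v)ₛₜ = B(v, c_s c_t v)` over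
ordered pairs `s = (p < q)`.

## Disproof.lean used (tree `Cruxes/GaussRankTwoCopies/Disproof.lean`, cdisprove gen 1, read in full)

* §1 `false_without_gaussianity` / `false_without_linearIndependence` (landed as
  `Negative.TightFour.gaussRankTwoCopies_false_without_*`, IMPORTED above): honoured at
  `stub_gaussianParity` (8 INDEPENDENT annihilators ⇒ maximal isotropic ⇒ 1-dim vacuum line ⇒ parity; with
  `A = 0` allowed a mixed-parity vector qualifies and S1 is false) and at `stub_transverseShape` /
  `stub_transverseDense` (pure-spinor structure: Lagrangian annihilators ⇒ `sp(8)` stabiliser; the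
  `Spin(16)`-orbit structure of the dictionary); with the predicate dropped `M⊗M` itself is a 1-term sum
  and indeed `M⊗M ∉ shapeLocus`.
* §2 `not_twoCopiesBound_four` / landed `gaussRankTwoCopies_tight_four`: respected — S2 is a statement
  about THREE terms (a 4-term sum has generic stabiliser `sl₂⁴`, no `E₆` confinement; `M⊗M = h_α + h_β`
  is the 4-corner decomposition), so the line does not prove too much.
* §3 `DistBound` / `crux_of_distBound`: this line proves MORE than the crux — `M⊗M ∉ closure(σ₃ cone)`
  (S2+S3+S4 give the shape on the closed cone) — i.e. border rank 4 and hence `∃ c > 0, DistBound 3 c`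
  qualitatively (not the value `1/4`); the crux is concluded directly, not through `crux_of_distBound`
  (Disproof.lean is a workfile, not imported).
* §4(6b) "no E-sector-only certificate": honoured — `bilin`/`momentT` live on all of `Δ(16)`; the
  invariants are `W(E₈)`-invariants mixing the `even⊗even` and `odd⊗odd` blocks (fingerprint
  `(tr T)²/tr T² = 50` universal, no quartic invariant; j008373, CHECKS.md).
* §5 `Parity.gaussianRank_not_multiplicative` (landed): honoured — parity is the FIRST step (S1 +
  `evenProj_magicMPow_two`); nothing multiplicative is claimed; no stub is an instance of the refuted
  multiplicativity (checked against `Negative/TightFour.lean`, the only landed Negative module).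
* §9: exact rank is settled on paper three ways; this line is the border-rank / `DistBound` engine.
  `ledger negatives --problem QuantumAdvantage` (1615, 2202, 8592, 9863): unrelated.

## Triage answers acted on

* r1-2 "state TShapeSecant3 as (transverse ⇒ shape) + (shape is Zariski-closed); no Angelini needed":
  DONE — S2 is the transverse statement (hypothesis `bilin (g i) (g j) ≠ 0`, i.e. `Lᵢ ∩ Lⱼ = 0`, where
  `∩ stab(gᵢ) ⊇ sp(σ)~ ≅ sp(8)` is elementary, Ideator3Notes §6.5), S3 closedness, S4 density.
* r1-1 "replace the charpoly shape by the scalar certificate R₁₆": NOT adopted for the registered stubs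
  (its integer coefficients come from one unreplicated derivation, j010640; a wrong digit would make the
  stub false), recorded in the line card as the alternative certificate for S2/S5 and as the effective
  route to `DistBound 3 c`.
* r1-1/2/3 "parity projection first; T(ψ) = T(ψ₊) + T(ψ₋)": DONE as S1 + the even re-decomposition.
* r1-3 "Lean cost is high (density/closure or full Lie theory) — honest cost": the cost is now split into
  named joints S2 (Lie theory OR one symbolic normal-form identity), S3 (proper map), S4 (analytic
  perturbation), S5 (finite computation), S1 (CAR algebra).
-/

noncomputable section

namespace Summit.QuantumAdvantage.QuantumAdvantage.Cruxes.GaussRankTwoCopies.E8CartanQuotient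

set_option linter.dupNamespace false

open Literature.Computability.QuantumComplexity Literature.Computability.Cryptography Matrix
open scoped BigOperators

/-! ## §1 Vocabulary (data only; tree conventions) -/

/-- Majorana labels `(wire j, X|Y)` of the 8-qubit register (`majorana (2*4) j b` of GaussianRank.lean). -/
abbrev MajIdx : Type := Fin (2 * 4) × Bool

/-- Jordan–Wigner position `0 … 15` of a Majorana label: `c_{j,X} ↦ 2j`, `c_{j,Y} ↦ 2j+1`. -/
def key (p : MajIdx) : ℕ := 2 * p.1.val + Bool.toNat p.2

/-- Labels of the standard basis `c_p c_q` (`p < q`) of `so(16) ≅ Λ²ℂ¹⁶`: 120 ordered pairs. -/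
abbrev SoIdx : Type := {pq : MajIdx × MajIdx // key pq.1 < key pq.2}

/-- The bivector `c_p c_q` of a label `s = (p < q)`, as an operator on 8 qubits. -/
def maj2 (s : SoIdx) : Matrix (QReg (2 * 4)) (QReg (2 * 4)) ℂ :=
  majorana (2 * 4) s.1.1.1 s.1.1.2 * majorana (2 * 4) s.1.2.1 s.1.2.2

/-- Charge conjugation `C = X ⊗ Y ⊗ X ⊗ Y ⊗ X ⊗ Y ⊗ X ⊗ Y` (X on even wires, Y on odd wires, 0-based):
`C c_p C = c_pᵀ` for all 16 Jordan–Wigner Majoranas, `C² = 1`, `Cᵀ = C`. -/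
def chargeConj : Matrix (QReg (2 * 4)) (QReg (2 * 4)) ℂ :=
  pauliString (fun i : Fin (2 * 4) => if i.val % 2 = 0 then Pauli.X else Pauli.Y)

/-- The `Spin(16)`-invariant symmetric bilinear form `B(φ, ψ) = φᵀ C ψ` on 8-qubit vectors (pairs the
even sector with itself and the odd sector with itself; bivectors are skew for it). -/
def bilin (φ ψ : QReg (2 * 4) → ℂ) : ℂ := φ ⬝ᵥ (chargeConj *ᵥ ψ)

/-- The MOMENT MATRIX `T(ψ)_{st} = B(ψ, c_s c_t ψ)` over bivector labels: up to a nonzero constant the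
matrix of `(ad ψ)²|so(16)` in the `ℤ₂`-graded Lie algebra `e₈ = so(16) ⊕ Δ₊(16)` (for even `ψ`). -/
def momentT (ψ : QReg (2 * 4) → ℂ) : Matrix SoIdx SoIdx ℂ :=
  Matrix.of fun s t => bilin ψ ((maj2 s * maj2 t) *ᵥ ψ)

/-- Projection onto the even-parity sector: keep the amplitudes on even-weight bit strings. -/
def evenProj (ψ : QReg (2 * 4) → ℂ) : QReg (2 * 4) → ℂ :=
  fun x => if (Finset.univ.filter (fun i => x i = true)).card % 2 = 0 then ψ x else 0

/-- The `E₆T₂` SHAPE of a characteristic polynomial: `X³⁶ · ∏ᵢ (X − uᵢ)²⁷ · ∏ⱼ (X − vⱼ)` (degree 120). -/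
def shapePoly (u v : Fin 3 → ℂ) : Polynomial ℂ :=
  Polynomial.X ^ 36 * (∏ i, (Polynomial.X - Polynomial.C (u i)) ^ 27) *
    ∏ j, (Polynomial.X - Polynomial.C (v j))

/-- The SHAPE LOCUS: 8-qubit vectors whose moment matrix has an `E₆T₂`-shaped characteristic
polynomial (the pull-back of the closed cone `π(⋃_{Ψ ≅ E₆} Ψ^⊥)` of the adjoint quotient). -/
def shapeLocus : Set (QReg (2 * 4) → ℂ) :=
  {x | ∃ u v : Fin 3 → ℂ, (momentT x).charpoly = shapePoly u v}

/-- TRANSVERSE EVEN 3-SUMS: linear combinations of three even Gaussian states whose annihilator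
Lagrangians are pairwise transverse (`B(gᵢ, gⱼ) ≠ 0`). Its closure is the third secant cone of the even
spinor variety. -/
def transverseSums : Set (QReg (2 * 4) → ℂ) :=
  {x | ∃ (a : Fin 3 → ℂ) (g : Fin 3 → QReg (2 * 4) → ℂ), (∀ i, IsGaussian (g i)) ∧
    (∀ i, evenProj (g i) = g i) ∧ (∀ i j, i ≠ j → bilin (g i) (g j) ≠ 0) ∧ x = ∑ i, a i • g i}

/-- ALL 3-term Gaussian combinations (either parity): `M⊗M ∉ allSums` is the crux, `M⊗M ∉ closure
allSums` is border rank 4 (both PROVED below from the five stubs). -/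
def allSums : Set (QReg (2 * 4) → ℂ) :=
  {x | ∃ (a : Fin 3 → ℂ) (g : Fin 3 → QReg (2 * 4) → ℂ), (∀ i, IsGaussian (g i)) ∧ x = ∑ i, a i • g i}

/-! ## §2 Registered stubs (the only `sorry`s of the line) -/

/-- **S1 `stub_gaussianParity`** [M; CAR algebra]. Every Gaussian state on 8 qubits is even or odd.
WHY TRUE: the annihilator space `L = {v : c(v) g = 0}` of `g ≠ 0` is isotropic (`c(v)² = (v·v)·1`), has
`dim L = 8` by `IsGaussian` (8 INDEPENDENT rows — Disproof §1 `false_without_linearIndependence` is spent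
here), hence is maximal isotropic and its joint kernel is ONE line (vacuum uniqueness: irreducibility of the
Clifford module); the parity operator `P = ∏ⱼ (−i c_{j,X} c_{j,Y})` anticommutes with every `c(v)`, so
`P g ∈ ker c(L) = ℂ g`, `P g = ± g`. LEANS ON: `majorana_anticommutator`, `linearIndependent_majorana`
(tree); shared with lines lagrangian-triple-rigidity / isotropy-defect (their `AnnihilatorIsLagrangian`,
vacuum uniqueness). -/
theorem stub_gaussianParity :
    ∀ g : QReg (2 * 4) → ℂ, IsGaussian g → evenProj g = g ∨ evenProj g = 0 := by
  sorry

/-- **S2 `stub_transverseShape`** [XL; THE LOAD-BEARING STUB — `E₈` confinement on the transverse locus].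
For three even Gaussian states with pairwise transverse annihilator Lagrangians and any coefficients,
`charpoly T(Σ aᵢgᵢ) = X³⁶ ∏ᵢ(X − uᵢ)²⁷ ∏ⱼ(X − vⱼ)`. WHY TRUE (paper proof, triage-verified ×3):
(i) `∩ᵢ stab_{so16}(gᵢ) ⊇ sp(σ)~ ≅ sp(8)` (Ideator3Notes §6.5 / Angelini 2011 Thm 5.1: `L₃ = graph(φ : L₁ →
L₂ ≅ L₁*)`, isotropy ⇒ `σ = ⟨·, φ·⟩` symplectic, `sp(σ)` is traceless on each `Lᵢ` so kills each `u_{Lᵢ}`);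
(ii) Kostant–Rallis for `(e₈, so16)`, `𝔭 = Δ₊`: `x = s + n`, `stab(x) ⊆ z(s)`, `z_𝔨(s) = 𝔩^θ` has
dimension `|Φ_s⁺|` and type = maximal compact of the split form of the Levi `𝔩`; (iii) `|Φ_s| ≥ 72` ⇒
`Φ_s ∈ {E₈, E₇, D₇, E₆A₁, E₆}`; `D₇` impossible (`z_𝔨 = so7 ⊕ so7 ⊉ sp(8)`, simple of dim 36 > 21);
the rest contain `E₆`, so `s ∈ Ψ^⊥` (`Ψ ≅ E₆`, `Φ ∩ Ψ^⊥ = A₂`) and `{α(s)² : α ∈ Φ⁺} = {0 ×36} ∪ {hᵢ² ×27}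
∪ {(hᵢ − hⱼ)²}` (`E₈ ⊃ E₆ × A₂: 240 = 72 + 6 + (27,3) + (27̄,3̄)`); (iv) `T(x) = κ · Mat (ad x)²|𝔨`
(`B`-duality of the bracket `𝔭 × 𝔭 → 𝔨`), `charpoly (ad x)²|𝔨 = charpoly (ad s)²|𝔨`. E₈-FREE
ALTERNATIVE: `Spin(16)·(ℂ×)³` is transitive on transverse even triples (`GL(8)` transitive on symplectic
forms) and `charpoly ∘ T` is `Spin(16)`-invariant, so S2 ⇔ ONE symbolic identity for Angelini's normal form
`a s₀ + b s₁ + c s₂` (`s₀ = |0⁸⟩`, `s₁,₂ = ∏ᵢ(1 ± a†_{2i}a†_{2i+1})|0⁸⟩`) in `ℚ[a,b,c][X]`. EVIDENCE: shape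
`t³⁶·(cubic)²⁷·(cubic)` with the `E₆T₂` fine structure on random and Angelini 3-sums (j008373 P2; j010601
T3 exact mod p; CHECKS.md r1-2; j010554 D1–D3 incl. degenerate/Fock/border sums). LEANS ON: Kostant–Rallis
1971, Adams (e₈ = so16 ⊕ Δ₊), Antonyan–Elashvili 1982, Lévay–Holweck 2018 §5, Angelini 2011 §5 — none in
Mathlib (honest XL). -/
theorem stub_transverseShape : transverseSums ⊆ shapeLocus := by
  sorry

/-- **S3 `stub_shapeClosed`** [M; topology of a proper map]. The shape locus is closed in `ℂ²⁵⁶`.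
WHY TRUE: `x ↦ charpoly T(x)` is polynomial in `x` (continuous into the coefficient space `ℂ¹²⁰` of monic
degree-120 polynomials) and the shape family `(u, v) ↦ coefficients of X³⁶∏(X−uᵢ)²⁷∏(X−vⱼ)` is a PROPER
map `ℂ⁶ → ℂ¹²⁰` (roots of a monic polynomial are bounded by its coefficients — Cauchy bound), so its image
is closed and `shapeLocus` is the preimage of a closed set. LEANS ON: Mathlib `isClosedMap`/proper maps,
`Polynomial` coefficient continuity; no Lie theory. -/
theorem stub_shapeClosed : IsClosed shapeLocus := by
  sorry

/-- **S4 `stub_transverseDense`** [L; analytic perturbation]. Every combination of three EVEN Gaussian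
states is a limit of combinations of three even Gaussian states with pairwise `B(g'ᵢ, g'ⱼ) ≠ 0`.
WHY TRUE: perturb `gᵢ ↦ Uᵢ(θ) gᵢ`, `U(θ) = ∏ₖ (cos θₖ + sin θₖ · c_{pₖ}c_{qₖ}) = ∏ₖ exp(θₖ c_{pₖ}c_{qₖ})`
(invertible, inverse `cos − sin·c c`; conjugates Majoranas to linear combinations of Majoranas, so
Gaussianity, linear independence of annihilators and parity are preserved); `F(θ) = B(gᵢ, U(θ)gⱼ)` is an
entire function whose square-free Taylor coefficients at `0` are `B(gᵢ, c_S gⱼ)` over all even `S`, not all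
zero because the even Clifford algebra acts on `Δ₊` as `End(Δ₊)` and `B|Δ₊` is non-degenerate; so along a
generic complex line the three pairings are nonzero analytic functions of one variable with isolated zeros,
nonzero for small `t ≠ 0`, and the perturbed sum tends to `Σ aᵢgᵢ`. LEANS ON: Mathlib analytic functions
(`AnalyticAt.eventually_eq_zero_or_eventually_ne_zero`), `majorana_mul_majorana_of_ne`,
`IsGaussian.majorana_mulVec`-style conjugation; no Lie theory. -/
theorem stub_transverseDense :
    ∀ (a : Fin 3 → ℂ) (g : Fin 3 → QReg (2 * 4) → ℂ), (∀ i, IsGaussian (g i)) →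
      (∀ i, evenProj (g i) = g i) → (∑ i, a i • g i) ∈ closure transverseSums := by
  sorry

/-- **S5 `stub_twoCopiesSpectrum`** [M/L; ONE finite exact computation — the `D₇` fingerprint of `M⊗M`].
The moment matrix of `|M⟩^{⊗2}` has characteristic polynomial `X⁴² (X − c)⁶⁴ (X − 4c)¹⁴`, `c ≠ 0`
(`{α(2ε₁)² : α ∈ Φ⁺(E₈)}` = `0` on the 42 positive `D₇` roots, `1` on the 64 half-spin roots, `4` on the 14
roots `ε₁ ± εⱼ`). WHY TRUE: confirmed EXACTLY (mod two primes: `T(T−c)(T−4c) = 0`, ranks 78/56/106;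
CHECKS.md r1-2, j010601 "spectrum exactly 0⁴² c⁶⁴ (4c)¹⁴", j008373 P1) for precisely this `T` and `C`.
LEAN ROUTE: `T(M⊗M)` is block-diagonal for the split 120 = 28_A + 28_B + 64_mixed (`B` is multiplicative
across the cut, `C = C_A ⊗ C_B`, and `B_A(m, c_a m) = 0` by parity): the mixed block is `c·1₆₄` (zero
covariance of GHZ₄: `B_A(m, c_ac_{a'} m) ∝ δ_{aa'}`), each in-block 28×28 block is the quartic covariant
of `m = |0000⟩+|1111⟩` with spectrum `{0²¹, (4c)⁷}` — so only 16×16 / 28×28 identities over `ℤ[i]` are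
needed (certificate: minimal polynomial + two traces, or explicit eigenprojectors). -/
theorem stub_twoCopiesSpectrum :
    ∃ c : ℂ, c ≠ 0 ∧ (momentT (magicMPow 2)).charpoly =
      Polynomial.X ^ 42 * (Polynomial.X - Polynomial.C c) ^ 64 *
        (Polynomial.X - Polynomial.C (4 * c)) ^ 14 := by
  sorry

/-! ## §3 Composition lemmas (real proofs, no `sorry` below this line) -/

/-! ### Even projection -/

theorem evenProj_add (φ ψ : QReg (2 * 4) → ℂ) : evenProj (φ + ψ) = evenProj φ + evenProj ψ := by
  funext x
  simp only [evenProj, Pi.add_apply]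
  split_ifs <;> simp

theorem evenProj_smul (c : ℂ) (ψ : QReg (2 * 4) → ℂ) : evenProj (c • ψ) = c • evenProj ψ := by
  funext x
  simp only [evenProj, Pi.smul_apply, smul_eq_mul]
  split_ifs <;> simp

theorem evenProj_sum_three (f : Fin 3 → QReg (2 * 4) → ℂ) :
    evenProj (∑ i, f i) = ∑ i, evenProj (f i) := by
  rw [Fin.sum_univ_three, Fin.sum_univ_three, evenProj_add, evenProj_add]

/-- Block-constant strings of eight bits have even weight (`decide` over the eight bits). -/
theorem card_even_of_blockConst_vec (b₀ b₁ b₂ b₃ b₄ b₅ b₆ b₇ : Bool) :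
    (∀ k : Fin 2, ∀ i : Fin 4,
        (fun w : Fin (2 * 4) => ![b₀, b₁, b₂, b₃, b₄, b₅, b₆, b₇] w) (finProdFinEquiv (k, i)) =
          (fun w : Fin (2 * 4) => ![b₀, b₁, b₂, b₃, b₄, b₅, b₆, b₇] w) (finProdFinEquiv (k, (0 : Fin 4)))) →
      (Finset.univ.filter (fun i : Fin (2 * 4) =>
          (fun w : Fin (2 * 4) => ![b₀, b₁, b₂, b₃, b₄, b₅, b₆, b₇] w) i = true)).card % 2 = 0 := by
  revert b₀ b₁ b₂ b₃ b₄ b₅ b₆ b₇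
  decide

/-- Every label on `2 * 4` wires is the vector of its eight values. -/
theorem eq_vec8 (x : QReg (2 * 4)) :
    x = fun w : Fin (2 * 4) => ![x 0, x 1, x 2, x 3, x 4, x 5, x 6, x 7] w := by
  funext w
  fin_cases w <;> rfl

/-- Block-constant labels on `2 * 4` wires have even weight. -/
theorem card_even_of_blockConst (x : QReg (2 * 4))
    (hbc : ∀ k : Fin 2, ∀ i : Fin 4, x (finProdFinEquiv (k, i)) = x (finProdFinEquiv (k, (0 : Fin 4)))) :
    (Finset.univ.filter (fun i : Fin (2 * 4) => x i = true)).card % 2 = 0 := by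
  revert hbc
  rw [eq_vec8 x]
  exact card_even_of_blockConst_vec _ _ _ _ _ _ _ _

/-- `|M⟩^{⊗2}` is even. -/
theorem evenProj_magicMPow_two : evenProj (magicMPow 2) = magicMPow 2 := by
  classical
  funext x
  simp only [evenProj]
  split_ifs with hx
  · rfl
  · rw [magicMPow_apply, if_neg]
    intro hbc
    exact hx (card_even_of_blockConst x hbc)

/-- The vacuum `|0⁸⟩` is even. -/
theorem evenProj_zeroState : evenProj (zeroState (2 * 4)) = zeroState (2 * 4) := by
  funext x
  simp only [evenProj]
  split_ifs with hx
  · rfl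
  · rw [zeroState, basisState_apply, if_neg]
    intro h
    apply hx
    rw [h]
    decide

/-! ### Root multiplicities of the two shapes at `0` -/

theorem rootMult_X_pow_zero (n : ℕ) :
    Polynomial.rootMultiplicity (0 : ℂ) (Polynomial.X ^ n) = n := by
  have h := Polynomial.rootMultiplicity_X_sub_C_pow (0 : ℂ) n
  rwa [Polynomial.C_0, sub_zero] at h

theorem rootMult_X_sub_C_pow_zero (a : ℂ) (n : ℕ) :
    Polynomial.rootMultiplicity (0 : ℂ) ((Polynomial.X - Polynomial.C a) ^ n) = if a = 0 then n else 0 := by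
  split_ifs with h
  · subst h
    exact Polynomial.rootMultiplicity_X_sub_C_pow (0 : ℂ) n
  · apply Polynomial.rootMultiplicity_eq_zero
    rw [Polynomial.IsRoot.def, Polynomial.eval_pow, Polynomial.eval_sub, Polynomial.eval_X,
      Polynomial.eval_C, zero_sub]
    exact pow_ne_zero _ (neg_ne_zero.mpr h)

theorem rootMult_X_sub_C_zero (a : ℂ) :
    Polynomial.rootMultiplicity (0 : ℂ) (Polynomial.X - Polynomial.C a) = if a = 0 then 1 else 0 := by
  have h := rootMult_X_sub_C_pow_zero a 1
  rwa [pow_one] at h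

theorem rootMult_prod_three (f : Fin 3 → Polynomial ℂ) (hf : ∀ i, (f i).Monic) (x : ℂ) :
    Polynomial.rootMultiplicity x (∏ i, f i) =
      Polynomial.rootMultiplicity x (f 0) + Polynomial.rootMultiplicity x (f 1) +
        Polynomial.rootMultiplicity x (f 2) := by
  rw [Fin.prod_univ_three, Polynomial.rootMultiplicity_mul (((hf 0).mul (hf 1)).mul (hf 2)).ne_zero,
    Polynomial.rootMultiplicity_mul ((hf 0).mul (hf 1)).ne_zero]

/-- Multiplicity of the root `0` of the `E₆T₂` shape: `36 + 27·#{i : uᵢ = 0} + #{j : vⱼ = 0}`. -/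
theorem rootMult_zero_shapePoly (u v : Fin 3 → ℂ) :
    Polynomial.rootMultiplicity (0 : ℂ) (shapePoly u v) =
      36 + ((if u 0 = 0 then 27 else 0) + (if u 1 = 0 then 27 else 0) + (if u 2 = 0 then 27 else 0)) +
        ((if v 0 = 0 then 1 else 0) + (if v 1 = 0 then 1 else 0) + (if v 2 = 0 then 1 else 0)) := by
  have hX : (Polynomial.X ^ 36 : Polynomial ℂ).Monic := Polynomial.monic_X_pow 36
  have hf : ∀ i, ((Polynomial.X - Polynomial.C (u i)) ^ 27).Monic :=
    fun i => (Polynomial.monic_X_sub_C (u i)).pow 27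
  have hg : ∀ j, (Polynomial.X - Polynomial.C (v j)).Monic := fun j => Polynomial.monic_X_sub_C (v j)
  have hP : (∏ i, (Polynomial.X - Polynomial.C (u i)) ^ 27).Monic :=
    Polynomial.monic_prod_of_monic _ _ (fun i _ => hf i)
  have hQ : (∏ j, (Polynomial.X - Polynomial.C (v j))).Monic :=
    Polynomial.monic_prod_of_monic _ _ (fun j _ => hg j)
  unfold shapePoly
  rw [Polynomial.rootMultiplicity_mul ((hX.mul hP).mul hQ).ne_zero,
    Polynomial.rootMultiplicity_mul (hX.mul hP).ne_zero, rootMult_X_pow_zero,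
    rootMult_prod_three _ hf, rootMult_prod_three _ hg,
    rootMult_X_sub_C_pow_zero, rootMult_X_sub_C_pow_zero, rootMult_X_sub_C_pow_zero,
    rootMult_X_sub_C_zero, rootMult_X_sub_C_zero, rootMult_X_sub_C_zero]

/-- Multiplicity of the root `0` of the `D₇` shape of `M⊗M`: exactly `42` (for `c ≠ 0`). -/
theorem rootMult_zero_twoCopiesShape {c : ℂ} (hc : c ≠ 0) :
    Polynomial.rootMultiplicity (0 : ℂ)
      (Polynomial.X ^ 42 * (Polynomial.X - Polynomial.C c) ^ 64 *
        (Polynomial.X - Polynomial.C (4 * c)) ^ 14) = 42 := by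
  have h1 : (Polynomial.X ^ 42 : Polynomial ℂ).Monic := Polynomial.monic_X_pow 42
  have h2 : ((Polynomial.X - Polynomial.C c) ^ 64).Monic := (Polynomial.monic_X_sub_C c).pow 64
  have h3 : ((Polynomial.X - Polynomial.C (4 * c)) ^ 14).Monic :=
    (Polynomial.monic_X_sub_C (4 * c)).pow 14
  have h4c : (4 : ℂ) * c ≠ 0 := mul_ne_zero (by norm_num) hc
  rw [Polynomial.rootMultiplicity_mul ((h1.mul h2).mul h3).ne_zero,
    Polynomial.rootMultiplicity_mul (h1.mul h2).ne_zero, rootMult_X_pow_zero,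
    rootMult_X_sub_C_pow_zero, rootMult_X_sub_C_pow_zero, if_neg hc, if_neg h4c]

/-! ### The shape on the whole 3-secant cone; border rank, metric gap, and the skeleton lemma -/

/-- S1 ⇒ the even projection of ANY 3-term Gaussian combination is a 3-term combination of EVEN
Gaussian states (odd terms are replaced by `0 • |0⁸⟩`). -/
theorem even_redecomposition
    (h1 : ∀ g : QReg (2 * 4) → ℂ, IsGaussian g → evenProj g = g ∨ evenProj g = 0)
    (a : Fin 3 → ℂ) (g : Fin 3 → QReg (2 * 4) → ℂ) (hg : ∀ i, IsGaussian (g i)) :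
    ∃ (a' : Fin 3 → ℂ) (g' : Fin 3 → QReg (2 * 4) → ℂ), (∀ i, IsGaussian (g' i)) ∧
      (∀ i, evenProj (g' i) = g' i) ∧ ∑ i, a' i • g' i = evenProj (∑ i, a i • g i) := by
  classical
  refine ⟨fun i => if evenProj (g i) = g i then a i else 0,
    fun i => if evenProj (g i) = g i then g i else zeroState (2 * 4), ?_, ?_, ?_⟩
  · intro i
    by_cases h : evenProj (g i) = g i
    · simp only [if_pos h]; exact hg i
    · simp only [if_neg h]; exact zeroState_isGaussian _
  · intro i
    by_cases h : evenProj (g i) = g i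
    · simp only [if_pos h]; exact h
    · simp only [if_neg h]; exact evenProj_zeroState
  · rw [evenProj_sum_three]
    refine Finset.sum_congr rfl fun i _ => ?_
    rw [evenProj_smul]
    by_cases h : evenProj (g i) = g i
    · simp only [if_pos h]; rw [h]
    · have h0 : evenProj (g i) = 0 := (h1 (g i) (hg i)).resolve_left h
      simp only [if_neg h]; rw [h0, smul_zero, zero_smul]

/-- S2 + S3 + S4 ⇒ every combination of three EVEN Gaussian states lies in the shape locus
(`closure transverseSums ⊆ shapeLocus`). -/
theorem shape_of_even (h2 : transverseSums ⊆ shapeLocus) (h3 : IsClosed shapeLocus)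
    (h4 : ∀ (a : Fin 3 → ℂ) (g : Fin 3 → QReg (2 * 4) → ℂ), (∀ i, IsGaussian (g i)) →
      (∀ i, evenProj (g i) = g i) → (∑ i, a i • g i) ∈ closure transverseSums)
    (a : Fin 3 → ℂ) (g : Fin 3 → QReg (2 * 4) → ℂ) (hg : ∀ i, IsGaussian (g i))
    (he : ∀ i, evenProj (g i) = g i) :
    ∑ i, a i • g i ∈ shapeLocus :=
  (h3.closure_subset_iff.mpr h2) (h4 a g hg he)

/-- The even projection is continuous (a coordinate projection of `ℂ²⁵⁶`). -/
theorem continuous_evenProj : Continuous evenProj := by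
  refine continuous_pi fun x => ?_
  by_cases hx : (Finset.univ.filter (fun i => x i = true)).card % 2 = 0
  · have hfun : (fun ψ : QReg (2 * 4) → ℂ => evenProj ψ x) = fun ψ => ψ x := by
      funext ψ; simp only [evenProj, if_pos hx]
    rw [hfun]; exact continuous_apply x
  · have hfun : (fun ψ : QReg (2 * 4) → ℂ => evenProj ψ x) = fun _ => 0 := by
      funext ψ; simp only [evenProj, if_neg hx]
    rw [hfun]; exact continuous_const

/-- **BORDER RANK 4 from the five stub statements:** `|M⟩^{⊗2}` is not a LIMIT of 3-term Gaussian
combinations. (Even projection of the cone lies in the closed shape locus; `M⊗M` is even; the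
multiplicity of the root `0` is `42 ∉ 36 + 27·{0..3} + {0..3}`.) -/
theorem borderRank_of_stubs
    (h1 : ∀ g : QReg (2 * 4) → ℂ, IsGaussian g → evenProj g = g ∨ evenProj g = 0)
    (h2 : transverseSums ⊆ shapeLocus) (h3 : IsClosed shapeLocus)
    (h4 : ∀ (a : Fin 3 → ℂ) (g : Fin 3 → QReg (2 * 4) → ℂ), (∀ i, IsGaussian (g i)) →
      (∀ i, evenProj (g i) = g i) → (∑ i, a i • g i) ∈ closure transverseSums)
    (h5 : ∃ c : ℂ, c ≠ 0 ∧ (momentT (magicMPow 2)).charpoly =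
      Polynomial.X ^ 42 * (Polynomial.X - Polynomial.C c) ^ 64 *
        (Polynomial.X - Polynomial.C (4 * c)) ^ 14) :
    magicMPow 2 ∉ closure allSums := by
  classical
  intro hmem
  have hA : evenProj '' allSums ⊆ shapeLocus := by
    rintro _ ⟨x, ⟨a, g, hg, rfl⟩, rfl⟩
    obtain ⟨a', g', hg', he', hsum⟩ := even_redecomposition h1 a g hg
    rw [← hsum]
    exact shape_of_even h2 h3 h4 a' g' hg' he'
  have hB : evenProj (magicMPow 2) ∈ closure (evenProj '' allSums) :=
    image_closure_subset_closure_image continuous_evenProj ⟨_, hmem, rfl⟩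
  rw [evenProj_magicMPow_two] at hB
  obtain ⟨u, v, huv⟩ := (h3.closure_subset_iff.mpr hA) hB
  obtain ⟨c, hc, hspec⟩ := h5
  have key : Polynomial.rootMultiplicity (0 : ℂ) (shapePoly u v) = 42 := by
    rw [← huv, hspec]
    exact rootMult_zero_twoCopiesShape hc
  rw [rootMult_zero_shapePoly] at key
  split_ifs at key <;> omega

/-- The squared sup-distance is dominated by the tree's `normSq` of the difference. -/
theorem dist_sq_le_normSq (φ ψ : QReg (2 * 4) → ℂ) : dist φ ψ ^ 2 ≤ normSq (φ - ψ) := by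
  rw [dist_eq_norm, Pi.norm_def]
  obtain ⟨x₀, -, hx₀⟩ := Finset.exists_mem_eq_sup (Finset.univ : Finset (QReg (2 * 4)))
    Finset.univ_nonempty (fun b => ‖(φ - ψ) b‖₊)
  rw [hx₀, coe_nnnorm]
  unfold normSq
  exact Finset.single_le_sum (f := fun x => ‖(φ - ψ) x‖ ^ 2) (fun _ _ => sq_nonneg _)
    (Finset.mem_univ x₀)

/-- **METRIC GAP from the five stub statements** (Disproof §3's open target `∃ c > 0, DistBound 3 c`,
stated over the named API): some positive `c` bounds `normSq (M⊗M − Σ_{i<3} aᵢ gᵢ)` from below for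
every 3-term Gaussian combination. -/
theorem distBound_of_stubs
    (h1 : ∀ g : QReg (2 * 4) → ℂ, IsGaussian g → evenProj g = g ∨ evenProj g = 0)
    (h2 : transverseSums ⊆ shapeLocus) (h3 : IsClosed shapeLocus)
    (h4 : ∀ (a : Fin 3 → ℂ) (g : Fin 3 → QReg (2 * 4) → ℂ), (∀ i, IsGaussian (g i)) →
      (∀ i, evenProj (g i) = g i) → (∑ i, a i • g i) ∈ closure transverseSums)
    (h5 : ∃ c : ℂ, c ≠ 0 ∧ (momentT (magicMPow 2)).charpoly =
      Polynomial.X ^ 42 * (Polynomial.X - Polynomial.C c) ^ 64 *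
        (Polynomial.X - Polynomial.C (4 * c)) ^ 14) :
    ∃ c : ℝ, 0 < c ∧ ∀ (a : Fin 3 → ℂ) (g : Fin 3 → QReg (2 * 4) → ℂ), (∀ i, IsGaussian (g i)) →
      c ≤ normSq (magicMPow 2 - ∑ i, a i • g i) := by
  have hB := borderRank_of_stubs h1 h2 h3 h4 h5
  rw [Metric.mem_closure_iff] at hB
  push Not at hB
  obtain ⟨ε, hε, hfar⟩ := hB
  refine ⟨ε ^ 2, pow_pos hε 2, fun a g hg => ?_⟩
  have hd : ε ≤ dist (magicMPow 2) (∑ i, a i • g i) := hfar _ ⟨a, g, hg, rfl⟩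
  calc ε ^ 2 ≤ dist (magicMPow 2) (∑ i, a i • g i) ^ 2 := pow_le_pow_left₀ hε.le hd 2
    _ ≤ normSq (magicMPow 2 - ∑ i, a i • g i) := dist_sq_le_normSq _ _

/-- **The five stub statements prove `χ_G(M⊗M) ≥ 4`** (named form over `IsGaussian` / `magicMPow`),
through the metric gap. -/
theorem twoCopies_of_stubs
    (h1 : ∀ g : QReg (2 * 4) → ℂ, IsGaussian g → evenProj g = g ∨ evenProj g = 0)
    (h2 : transverseSums ⊆ shapeLocus) (h3 : IsClosed shapeLocus)
    (h4 : ∀ (a : Fin 3 → ℂ) (g : Fin 3 → QReg (2 * 4) → ℂ), (∀ i, IsGaussian (g i)) →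
      (∀ i, evenProj (g i) = g i) → (∑ i, a i • g i) ∈ closure transverseSums)
    (h5 : ∃ c : ℂ, c ≠ 0 ∧ (momentT (magicMPow 2)).charpoly =
      Polynomial.X ^ 42 * (Polynomial.X - Polynomial.C c) ^ 64 *
        (Polynomial.X - Polynomial.C (4 * c)) ^ 14) :
    ∀ (a : Fin 3 → ℂ) (g : Fin 3 → QReg (2 * 4) → ℂ), (∀ i, IsGaussian (g i)) →
      magicMPow 2 ≠ ∑ i, a i • g i := by
  obtain ⟨c, hc, hfar⟩ := distBound_of_stubs h1 h2 h3 h4 h5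
  intro a g hg heq
  have h := hfar a g hg
  rw [← heq, sub_self] at h
  have h0 : normSq (0 : QReg (2 * 4) → ℂ) = 0 := by simp [normSq]
  rw [h0] at h
  exact absurd (lt_of_lt_of_le hc h) (lt_irrefl 0)

/-! ## §4 The skeleton theorem: the five stubs prove the crux BY NAME -/

/-- **`GaussRankTwoCopies` from the five registered stubs.** The route decl unfolds (three `let`s,
`Iff.rfl`-identical to the named API: Disproof §0 `crux_iff`) to
`∀ a g, (∀ i, IsGaussian (g i)) → magicMPow 2 ≠ Σ aᵢ • gᵢ`; `twoCopies_of_stubs` is that statement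
(obtained through `borderRank_of_stubs` ⇒ `distBound_of_stubs`). The only gaps the audit sees are the
five `sorry`s of §2. -/
theorem GaussRankTwoCopies_of :
    Summit.QuantumAdvantage.QuantumAdvantage.Theses.SpinorFlattening.GaussRankTwoCopies := by
  intro a g hg
  exact twoCopies_of_stubs stub_gaussianParity stub_transverseShape stub_shapeClosed
    stub_transverseDense stub_twoCopiesSpectrum a g hg

end Summit.QuantumAdvantage.QuantumAdvantage.Cruxes.GaussRankTwoCopies.E8CartanQuotient

end
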